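/-
Copyright (c) 2026 the pub-hodgecm-mathlib formalisation cell (harness21).  Prover seat hodgecm-mathlib-LH4-p06 (g5), Track A «(D-RAM) FOUR-FRAME», unit U2H, census leaf
(ρ2b′-X) `stub_U2H_fixedPointCensus_typeTwo_unit0` — SOCKET (C) `orderCountCensusC` (type RamM), hand (C-1M) «the u-FREE `−` TABLE `hnM` of ★ p857711» (LH4-p04 (g5) SOCKET (C)
LEAD LINES #1–#2): `#levelSet_{h′}(j,a)` for EVERY cell, anchored (non-norm) class at even K♮-levels.  2026-09-04.
-/
import Summits.HodgeConjecture.HodgeConjecture.Theorems.F0P3cDyRamToricLevelCensusRamMTablesPrep   -- (C-1 prep, this seat): row engines + `met_iff_le_threshold_of_anchor`; brings ★ T5c base, ★ p857782, ★ p857465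
import HarnessLib

/-!
# T5c (C-1M): the u-free `−` table of the RamM census — `#levelSet_{h′}(j,a) = ‹★ p857711's hnM›` for every `(j, a)`

Cell `hodgecm-mathlib` (D-0151), FLOOR 0, crux H413 = `stmt-HodgeConjecture-24833`; squad F0∕P3c∕LH4; lane `--supports stmt-HodgeConjecture-24833 --as helper` (count-neutral).
THEOREMS ONLY (no `def`, no instance, no notation, no `sorry`, default heartbeats).  Socket served: LH4-p04 (g5)'s SOCKET (C), letter `hnM` of ★ `toricCensusSum_ramM` for
`nM j a := #levelSet_{h′}(j,a)` — the `ℕ`-expression of ★ p857711 :68–:71 VERBATIM (K♮-level `k = j − a − s0`):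
`j = 0 ↦ [a = 0]`; `j < a ↦ 0`; `k = −1 ↦ q^j`; `k < −1 ↦ [a = 0]·q^j`; `k` odd `↦ 0`; `k` even, `a = 0 ↦ [k + 2 ≤ 2g]·q^{j−k∕2}`;
`k` even, `a ≥ 1 ↦ (q−1)q^{j−1−k∕2} ∣ q^{j−k∕2} ∣ 0` on `k + 2 <,=,> 2g`.
ROWS: shallow ∕ `k = −1` ∕ odd rows = (C-1 prep) engines under the class letters of `h′` (`hcls0`, `hclsO`); even rows `k ≥ 0` = the ANCHORED class (`hclsE`: even parity
`k₀ + s0 + e` ⇒ `η′(k₀)·t(ω₀)·ψ(n₀) = −1`, `n₀` the `Θ`-fixed unit non-norm — the anisotropic line), met at K♮-level `k` iff `k + 2 ≤ dΘ` ((C-1 prep)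
`met_iff_le_threshold_of_anchor`), counted by ★ p857782 with ★ p857465's indices `[U_M : B_k] = q^{k∕2}` below the threshold.
HONEST LABEL.  Count-neutral (`--supports`); unconditional local algebra; nothing of (ρ2b′-X) is asserted — `HC_CM` is proved only modulo the 7 printed citations (2 remaining named
inputs: hLiu418 = `stmt-HodgeConjecture-24832`, h413 = `stmt-HodgeConjecture-24833`) until rung 0 closes.

## References
* [Flicker1998UnitaryFL] Y. Z. Flicker, *Elementary proof of the fundamental lemma for a unitary group*, Canad. J. Math. 50 (1998): Prop. 7 p. 84 (the level tables).
* [Serre1979] J.-P. Serre, *Local Fields*, GTM 67 (1979): Ch. V §3 Cor. 3.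
* [Jacobowitz1962] R. Jacobowitz, *Hermitian forms over local fields*, Amer. J. Math. 84 (1962): §4.
-/

set_option autoImplicit false

noncomputable section

namespace Summit.HodgeConjecture.HodgeConjecture.Cruxes.H413.F0P3cDyRamToricLevelCensusRamM

open WithZero IsLocalRing
open scoped Valued Pointwise
open Literature.NumberTheory.Automorphic.UnitaryThreeFourFrame (IsRamifiedQuadraticDatum)
open Literature.NumberTheory.LocalFields.QuadraticOrder Literature.NumberTheory.LocalFields.WildQuadraticDatum
open Summit.HodgeConjecture.HodgeConjecture.Cruxes.H413.F0P3cDyRamToricCensusDefs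

variable {K : Type} [Field K] [Valued K ℤᵐ⁰] {ρ Θ : K →+* K} {α ϖE h : K} {dρ t : ℕ}
variable {K' : Type*} [Field K'] [Valued K' ℤᵐ⁰] {σ' : K' →+* K'} {π' : K'} {d' : ℕ}

/-! ## §1 The anchored class at an even K♮-level: the three counts -/

/-- **ANCHORED CLASS, `a ≥ 1`, EVEN K♮-LEVEL `k = 2n`** (`2(d′ + 2n) + 2a = 2j + d_ρ`): `#levelSet(j,a) = (q−1)q^{j−1−n} ∣ q^{j−n} ∣ 0` on `2n + 2 <,=,> dΘ`
(met at `k` iff `2n + 2 ≤ dΘ`, at `k + 1` iff `2n + 3 ≤ dΘ`; ★ p857782's three counts with `[B_k : 𝒪_jˣ] = q^j ∕ q^n`, `[B_{k+1} : 𝒪_jˣ] = q^j ∕ q^{n+1}` below the threshold).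
[cite: Flicker1998UnitaryFL, Prop. 7 p. 84] [cite: Serre1979, Ch. V §3 Cor. 3] -/
theorem ncard_levelSet_pos_eq_of_anchor_even [CompleteSpace K] [IsDiscreteValuationRing 𝒪[K]] [Finite 𝓀[K]] [IsDiscreteValuationRing 𝒪[K']] [Finite 𝓀[K']]
    (hD : IsRamifiedQuadraticDatum ρ α dρ t) (hΘρ : ∀ x, Θ (ρ x) = ρ (Θ x)) (hvΘ : ∀ x, Valued.v (Θ x) = Valued.v x)
    (hϖE : Valued.v ϖE = exp (-2 : ℤ)) (hρϖ : ρ ϖE = ϖE) {q : ℕ} (hq : Nat.card 𝓀[K] = q) (hq' : Nat.card 𝓀[K'] = q)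
    (hσ' : ∀ x, σ' (σ' x) = x) (hvσ' : ∀ x, Valued.v (σ' x) = Valued.v x) (hfix' : ∀ x : K', σ' x = x → x ≠ 0 → ∃ n : ℤ, Valued.v x = exp (2 * n))
    (hπ' : Valued.v π' = exp (-1 : ℤ)) (hdd' : Valued.v (π' - σ' π') = Valued.v π' ^ d')
    (jK : K' →+* K) (hjle : ∀ x y : K', Valued.v (jK x) ≤ Valued.v (jK y) ↔ Valued.v x ≤ Valued.v y) (hjΘ : ∀ x, Θ (jK x) = jK x)
    (hjfix : ∀ z : K, Θ z = z → ∃ x, jK x = z) (hjσ : ∀ x, jK (σ' x) = ρ (jK x)) (hjπ : Valued.v (jK π') = exp (-2 : ℤ))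
    {ϖ : K} {dΘ tΘ : ℕ} (hDΘ : IsRamifiedQuadraticDatum Θ ϖ dΘ tΘ)
    (hFN : ∀ f : K, ρ f = f → Θ f = f → Valued.v f = 1 → ∃ x : K, x * Θ x = f)
    {n₀ : K} (hΘn₀ : Θ n₀ = n₀) (hn₀1 : Valued.v n₀ = 1) (hn₀N : ¬ ∃ z : K, z * Θ z = n₀)
    (hΘh : Θ h = h) (hh : h ≠ 0) {vh : ℤ} (hvh : Valued.v h = exp (-vh)) (j : ℕ) {a : ℕ} (ha : 1 ≤ a) {k₀ : ℤ} (hk₀ : vh + dρ + 2 * k₀ + 2 * j = 2 * a)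
    {n : ℕ} (hn : 2 * ((d' : ℤ) + 2 * n) + 2 * a = 2 * j + dρ) (hdρd : dρ ≤ 2 * d') {ω₀ : Kˣ} (hω₀ : Valued.v (ω₀ : K) = 1)
    (hanch : ρ h / h * (ρ (α ^ k₀ * Θ (α ^ k₀)) / (α ^ k₀ * Θ (α ^ k₀))) * (ρ ((ω₀ : K) * Θ ω₀) / ((ω₀ : K) * Θ ω₀)) * (ρ n₀ / n₀) = -1) :
    (levelSet ρ Θ α ϖE h j a).ncard = if 2 * n + 2 < dΘ then (q - 1) * q ^ (j - 1 - n) else if 2 * n + 2 = dΘ then q ^ (j - n) else 0 := by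
  obtain ⟨hρρ, hvρ, hα, hfix, -, -, -⟩ := id hD
  have hΘΘ := hDΘ.1
  have hρα := map_ne_self_of_datum hD
  have hdρ := v_sub_map_eq_exp_of_datum hD
  have hq0 : 0 < q := Nat.pos_of_ne_zero (card_residueField_ne_zero hq)
  have hnj : n + 1 ≤ j := by omega
  -- radii
  have hR : exp (2 * (a : ℤ) - 2 * j - dρ) = Valued.v (jK π' ^ (d' + 2 * n)) := by
    rw [v_map_pow_eq_exp_neg_two_mul jK hjπ]; congr 1; push_cast; omega
  have hR1 : Valued.v (jK π' ^ (d' + (2 * n + 1))) = exp (2 * (a : ℤ) - 2 * j - dρ - 2) := by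
    rw [v_map_pow_eq_exp_neg_two_mul jK hjπ]; congr 1; push_cast; omega
  have hmet := met_iff_le_threshold_of_anchor hvΘ hvρ hσ' hvσ' hfix' hπ' hdd' jK hjle hjΘ hjfix hjσ hjπ hDΘ hFN hΘn₀ hn₀1 hn₀N hω₀ hanch
  -- subgroups and indices
  obtain ⟨U, hU⟩ := Literature.NumberTheory.LocalFields.WildQuadraticDatum.exists_subgroup_v_eq_one (K := K)
  obtain ⟨H, hH⟩ := exists_subgroup_orderUnits (ρ := ρ) (α := α) hvρ (ϖE ^ j)
  obtain ⟨Ut, hUt⟩ := exists_subgroup_thetaFixed_units (K := K) (Θ := Θ)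
  obtain ⟨B, hB⟩ := exists_subgroup_normDepth (Θ := Θ) hvρ hvΘ (exp (2 * (a : ℤ) - 2 * j - dρ))
  obtain ⟨B', hB'⟩ := exists_subgroup_normDepth (Θ := Θ) hvρ hvΘ (exp (2 * (a : ℤ) - 2 * j - dρ - 1))
  obtain ⟨Vt, hVt⟩ := exists_subgroup_thetaFixed_depth (Θ := Θ) hvρ (Valued.v (jK π' ^ (d' + 2 * n)))
  obtain ⟨Vt', hVt'⟩ := exists_subgroup_thetaFixed_depth (Θ := Θ) hvρ (Valued.v (jK π' ^ (d' + (2 * n + 1))))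
  have hBj : ∀ ω : Kˣ, ω ∈ B ↔ Valued.v (ω : K) = 1 ∧ Valued.v ((ω : K) * Θ ω - ρ ((ω : K) * Θ ω)) ≤ Valued.v (jK π' ^ (d' + 2 * n)) := by
    intro ω; rw [hB, hR]
  have hB'j : ∀ ω : Kˣ, ω ∈ B' ↔ Valued.v (ω : K) = 1 ∧ Valued.v ((ω : K) * Θ ω - ρ ((ω : K) * Θ ω)) ≤ Valued.v (jK π' ^ (d' + (2 * n + 1))) := by
    intro ω
    rw [hB', hR1, show (2 * (a : ℤ) - 2 * j - dρ - 1) = 2 * (-((d' : ℤ) + 2 * n)) - 1 by omega,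
      v_le_exp_odd_iff_of_theta_fixed hDΘ (theta_norm_sub_map hΘΘ hΘρ _), show 2 * (-((d' : ℤ) + 2 * n)) - 2 = 2 * (a : ℤ) - 2 * j - dρ - 2 by omega]
  have hHU : H.relIndex U = q ^ j := relIndex_orderUnits_eq_of_isRamifiedQuadraticDatum hD hϖE hq j U H hU hH
  have hHB' : H ≤ B' := orderUnits_le_normDepth hvρ hΘρ hvΘ (by rw [v_conductorR (ρ := ρ) hdρ hϖE j, exp_le_exp]; omega) hH hB'
  have hB'B : B' ≤ B := fun ω hω => (hB ω).2 ⟨((hB' ω).1 hω).1, ((hB' ω).1 hω).2.trans (by rw [exp_le_exp]; omega)⟩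
  have hBU : B ≤ U := fun ω hω => (hU ω).2 ((hB ω).1 hω).1
  have hIB : B.relIndex U = if dΘ ≤ 2 * n + 1 then q ^ n / 2 else q ^ n :=
    relIndex_normDepth_eq_ite_pow_of_ramified hσ' hvσ' hfix' hπ' hdd' hq' jK hjle hjΘ hjfix hjσ hjπ hDΘ hFN n U Ut Vt B hU hUt hVt hBj
  have hIB' : B'.relIndex U = if dΘ ≤ 2 * n + 2 then q ^ (n + 1) / 2 else q ^ (n + 1) :=
    relIndex_normDepth_odd_eq_ite_pow_of_ramified hσ' hvσ' hfix' hπ' hdd' hq' jK hjle hjΘ hjfix hjσ hjπ hDΘ hFN n U Ut Vt' B' hU hUt hVt' hB'j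
  have htB : H.relIndex B * B.relIndex U = q ^ j := by rw [Subgroup.relIndex_mul_relIndex H B U (hHB'.trans hB'B) hBU, hHU]
  have htB' : H.relIndex B' * B'.relIndex U = q ^ j := by rw [Subgroup.relIndex_mul_relIndex H B' U hHB' (hB'B.trans hBU), hHU]
  have hqj : q ^ j ≠ 0 := pow_ne_zero _ (card_residueField_ne_zero hq)
  have hHB0 : H.relIndex B ≠ 0 := fun h0 => hqj (by rw [← htB, h0, zero_mul])
  by_cases hlt : 2 * n + 2 < dΘ
  · ---------------------------------------------------------------- met at `k` and at `k + 1`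
    rw [if_pos hlt]
    obtain ⟨ω₁, hω₁, hle⟩ := (hmet (2 * n + 1)).2 (by omega)
    have hcnt : (levelSet ρ Θ α ϖE h j a).ncard = H.relIndex B - H.relIndex B' :=
      ncard_levelSetR_eq_relIndex_sub_of_le hρρ hvρ hvΘ hfix hρα hα hdρ hϖE hρϖ hh hvh j ha hk₀ hω₁ (by rw [hR1] at hle; exact hle.trans (by rw [exp_le_exp]; omega))
        H B B' hH hB hB' hHB' (finite_image_mk_smul_of_relIndex_ne_zero H B ω₁ hHB0)
    rw [if_neg (show ¬ dΘ ≤ 2 * n + 1 by omega)] at hIB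
    rw [if_neg (show ¬ dΘ ≤ 2 * n + 2 by omega)] at hIB'
    have h1 : H.relIndex B = q ^ (j - n) := by
      rw [← Nat.pow_div (by omega : n ≤ j) hq0, ← htB, hIB, Nat.mul_div_cancel _ (pow_pos hq0 n)]
    have h2 : H.relIndex B' = q ^ (j - (n + 1)) := by
      rw [← Nat.pow_div hnj hq0, ← htB', hIB', Nat.mul_div_cancel _ (pow_pos hq0 _)]
    rw [hcnt, h1, h2, show j - n = (j - 1 - n) + 1 by omega, show j - (n + 1) = j - 1 - n by omega, pow_succ, Nat.sub_mul, one_mul, mul_comm]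
  rw [if_neg hlt]
  by_cases heq : 2 * n + 2 = dΘ
  · ---------------------------------------------------------------- met at `k`, not at `k + 1`
    rw [if_pos heq]
    obtain ⟨ω₁, hω₁, hle⟩ := (hmet (2 * n)).2 (by omega)
    have hnone : ∀ ω : Kˣ, Valued.v (ω : K) = 1 →
        ¬ Valued.v (1 + ρ h / h * (ρ (α ^ k₀ * Θ (α ^ k₀)) / (α ^ k₀ * Θ (α ^ k₀))) * (ρ ((ω : K) * Θ ω) / ((ω : K) * Θ ω))) ≤
          exp (2 * (a : ℤ) - 2 * j - dρ - 1) := fun ω hω hle' => by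
      have hodd := (v_le_exp_odd_iff_of_theta_fixed hDΘ (theta_one_add_classMult_mul_twist hΘΘ hΘρ hΘh k₀ (ω : K)) (-((d' : ℤ) + 2 * n))).1
        (hle'.trans (by rw [exp_le_exp]; omega))
      have hmet1 : ∃ ω₁ : Kˣ, Valued.v (ω₁ : K) = 1 ∧
          Valued.v (1 + ρ h / h * (ρ (α ^ k₀ * Θ (α ^ k₀)) / (α ^ k₀ * Θ (α ^ k₀))) * (ρ ((ω₁ : K) * Θ ω₁) / ((ω₁ : K) * Θ ω₁))) ≤
            Valued.v (jK π' ^ (d' + (2 * n + 1))) := ⟨ω, hω, by rw [hR1]; exact hodd.trans (by rw [exp_le_exp]; omega)⟩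
      have h3 := (hmet (2 * n + 1)).1 hmet1
      omega
    have hcnt : (levelSet ρ Θ α ϖE h j a).ncard = H.relIndex B :=
      ncard_levelSetR_eq_relIndex_of_le_of_forall_not hρρ hvρ hvΘ hfix hρα hα hdρ hϖE hρϖ hh hvh j ha hk₀ hω₁ (by rw [hR]; exact hle) hnone H B hH hB
    rw [if_neg (show ¬ dΘ ≤ 2 * n + 1 by omega)] at hIB
    rw [hcnt, ← Nat.pow_div (by omega : n ≤ j) hq0, ← htB, hIB, Nat.mul_div_cancel _ (pow_pos hq0 n)]
  · ---------------------------------------------------------------- not met at `k`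
    rw [if_neg heq]
    refine ncard_levelSet_pos_eq_zero_of_notMet hD hvΘ hϖE hρϖ hh hvh j ha hk₀ fun ω hω hle => ?_
    have h3 := (hmet (2 * n)).1 ⟨ω, hω, by rw [← hR]; exact hle⟩
    omega

/-- **ANCHORED CLASS, `a = 0`, EVEN K♮-LEVEL `k = 2n`** (`2(d′ + 2n) = 2j + d_ρ`): `#levelSet(j,0) = [2n + 2 ≤ dΘ]·q^{j−n}`.
[cite: Flicker1998UnitaryFL, Prop. 7 p. 84] [cite: Serre1979, Ch. V §3 Cor. 3] -/
theorem ncard_levelSet_zero_eq_of_anchor_even [CompleteSpace K] [IsDiscreteValuationRing 𝒪[K]] [Finite 𝓀[K]] [IsDiscreteValuationRing 𝒪[K']] [Finite 𝓀[K']]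
    (hD : IsRamifiedQuadraticDatum ρ α dρ t) (hΘρ : ∀ x, Θ (ρ x) = ρ (Θ x)) (hvΘ : ∀ x, Valued.v (Θ x) = Valued.v x)
    (hϖE : Valued.v ϖE = exp (-2 : ℤ)) (hρϖ : ρ ϖE = ϖE) {q : ℕ} (hq : Nat.card 𝓀[K] = q) (hq' : Nat.card 𝓀[K'] = q)
    (hσ' : ∀ x, σ' (σ' x) = x) (hvσ' : ∀ x, Valued.v (σ' x) = Valued.v x) (hfix' : ∀ x : K', σ' x = x → x ≠ 0 → ∃ n : ℤ, Valued.v x = exp (2 * n))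
    (hπ' : Valued.v π' = exp (-1 : ℤ)) (hdd' : Valued.v (π' - σ' π') = Valued.v π' ^ d')
    (jK : K' →+* K) (hjle : ∀ x y : K', Valued.v (jK x) ≤ Valued.v (jK y) ↔ Valued.v x ≤ Valued.v y) (hjΘ : ∀ x, Θ (jK x) = jK x)
    (hjfix : ∀ z : K, Θ z = z → ∃ x, jK x = z) (hjσ : ∀ x, jK (σ' x) = ρ (jK x)) (hjπ : Valued.v (jK π') = exp (-2 : ℤ))
    {ϖ : K} {dΘ tΘ : ℕ} (hDΘ : IsRamifiedQuadraticDatum Θ ϖ dΘ tΘ)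
    (hFN : ∀ f : K, ρ f = f → Θ f = f → Valued.v f = 1 → ∃ x : K, x * Θ x = f)
    {n₀ : K} (hΘn₀ : Θ n₀ = n₀) (hn₀1 : Valued.v n₀ = 1) (hn₀N : ¬ ∃ z : K, z * Θ z = n₀)
    (hh : h ≠ 0) {vh : ℤ} (hvh : Valued.v h = exp (-vh)) (j : ℕ) {k₀ : ℤ} (hk₀ : vh + dρ + 2 * k₀ + 2 * j = 0)
    {n : ℕ} (hn : 2 * ((d' : ℤ) + 2 * n) = 2 * j + dρ) (hdρd : dρ ≤ 2 * d') {ω₀ : Kˣ} (hω₀ : Valued.v (ω₀ : K) = 1)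
    (hanch : ρ h / h * (ρ (α ^ k₀ * Θ (α ^ k₀)) / (α ^ k₀ * Θ (α ^ k₀))) * (ρ ((ω₀ : K) * Θ ω₀) / ((ω₀ : K) * Θ ω₀)) * (ρ n₀ / n₀) = -1) :
    (levelSet ρ Θ α ϖE h j 0).ncard = if 2 * n + 2 ≤ dΘ then q ^ (j - n) else 0 := by
  obtain ⟨hρρ, hvρ, hα, hfix, -, -, -⟩ := id hD
  have hρα := map_ne_self_of_datum hD
  have hdρ := v_sub_map_eq_exp_of_datum hD
  have hq0 : 0 < q := Nat.pos_of_ne_zero (card_residueField_ne_zero hq)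
  have hR : exp (-(2 * (j : ℤ) + dρ)) = Valued.v (jK π' ^ (d' + 2 * n)) := by
    rw [v_map_pow_eq_exp_neg_two_mul jK hjπ]; congr 1; push_cast; omega
  have hmet := met_iff_le_threshold_of_anchor hvΘ hvρ hσ' hvσ' hfix' hπ' hdd' jK hjle hjΘ hjfix hjσ hjπ hDΘ hFN hΘn₀ hn₀1 hn₀N hω₀ hanch (2 * n)
  by_cases hle2 : 2 * n + 2 ≤ dΘ
  · rw [if_pos hle2]
    obtain ⟨ω₁, hω₁, hle⟩ := hmet.2 hle2
    obtain ⟨U, hU⟩ := Literature.NumberTheory.LocalFields.WildQuadraticDatum.exists_subgroup_v_eq_one (K := K)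
    obtain ⟨H, hH⟩ := exists_subgroup_orderUnits (ρ := ρ) (α := α) hvρ (ϖE ^ j)
    obtain ⟨Ut, hUt⟩ := exists_subgroup_thetaFixed_units (K := K) (Θ := Θ)
    obtain ⟨B, hB⟩ := exists_subgroup_normDepth (Θ := Θ) hvρ hvΘ (exp (-(2 * (j : ℤ) + dρ)))
    obtain ⟨Vt, hVt⟩ := exists_subgroup_thetaFixed_depth (Θ := Θ) hvρ (Valued.v (jK π' ^ (d' + 2 * n)))
    have hBj : ∀ ω : Kˣ, ω ∈ B ↔ Valued.v (ω : K) = 1 ∧ Valued.v ((ω : K) * Θ ω - ρ ((ω : K) * Θ ω)) ≤ Valued.v (jK π' ^ (d' + 2 * n)) := by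
      intro ω; rw [hB, hR]
    have hHB : H ≤ B := orderUnits_le_normDepth hvρ hΘρ hvΘ (by rw [v_conductorR (ρ := ρ) hdρ hϖE j]) hH hB
    have hBU : B ≤ U := fun ω hω => (hU ω).2 ((hB ω).1 hω).1
    have hIB : B.relIndex U = if dΘ ≤ 2 * n + 1 then q ^ n / 2 else q ^ n :=
      relIndex_normDepth_eq_ite_pow_of_ramified hσ' hvσ' hfix' hπ' hdd' hq' jK hjle hjΘ hjfix hjσ hjπ hDΘ hFN n U Ut Vt B hU hUt hVt hBj
    rw [if_neg (show ¬ dΘ ≤ 2 * n + 1 by omega)] at hIB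
    have htB : H.relIndex B * B.relIndex U = q ^ j := by
      rw [Subgroup.relIndex_mul_relIndex H B U hHB hBU, relIndex_orderUnits_eq_of_isRamifiedQuadraticDatum hD hϖE hq j U H hU hH]
    have hcnt : (levelSet ρ Θ α ϖE h j 0).ncard = H.relIndex B :=
      ncard_levelSetR_zero_eq_relIndex_of_le hρρ hvρ hvΘ hfix hρα hα hdρ hϖE hρϖ hh hvh j hk₀ hω₁ (by rw [hR]; exact hle) H B hH hB
    rw [hcnt, ← Nat.pow_div (by omega : n ≤ j) hq0, ← htB, hIB, Nat.mul_div_cancel _ (pow_pos hq0 n)]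
  · rw [if_neg hle2]
    refine ncard_levelSet_zero_eq_zero_of_notMet hD hvΘ hϖE hρϖ hh hvh j hk₀ fun ω hω hle => ?_
    have h3 := hmet.1 ⟨ω, hω, by rw [← hR]; exact hle⟩
    omega

/-! ## §2 The `−` table -/

/-- **THE u-FREE `−` TABLE `hnM` OF ★ `toricCensusSum_ramM`.**  Frame as in the `+` table (★ `ncard_levelSet_eq_hnP`) plus the `Θ`-fixed unit non-norm `n₀`; CLASS LETTERS of
the scalar `h` (here the ANISOTROPIC line's scalar) indexed by `k₀` (`η(k₀) = (ρh∕h)·t(α^{k₀})`, `v_h + d_ρ = 2e`): `hcls0`, `hclsE` (even `k₀ + s0 + e`: an ANCHOR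
`η(k₀)·t(ω₀)·ψ(n₀) = −1`), `hclsO` (odd: not met at K♮-depth `d′`).  Then for all `j a`: `#levelSet_h(j,a) =` ★ p857711's `hnM` expression.
[cite: Flicker1998UnitaryFL, Prop. 7 p. 84] [cite: Serre1979, Ch. V §3 Cor. 3] [cite: Jacobowitz1962, §4] -/
theorem ncard_levelSet_eq_hnM [CompleteSpace K] [IsDiscreteValuationRing 𝒪[K]] [Finite 𝓀[K]] [IsDiscreteValuationRing 𝒪[K']] [Finite 𝓀[K']]
    (hD : IsRamifiedQuadraticDatum ρ α dρ t) (hΘρ : ∀ x, Θ (ρ x) = ρ (Θ x)) (hvΘ : ∀ x, Valued.v (Θ x) = Valued.v x)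
    (hϖE : Valued.v ϖE = exp (-2 : ℤ)) (hρϖ : ρ ϖE = ϖE) {q : ℕ} (hq : Nat.card 𝓀[K] = q) (hq' : Nat.card 𝓀[K'] = q)
    (hσ' : ∀ x, σ' (σ' x) = x) (hvσ' : ∀ x, Valued.v (σ' x) = Valued.v x) (hfix' : ∀ x : K', σ' x = x → x ≠ 0 → ∃ n : ℤ, Valued.v x = exp (2 * n))
    (hπ' : Valued.v π' = exp (-1 : ℤ)) (hdd' : Valued.v (π' - σ' π') = Valued.v π' ^ d')
    (jK : K' →+* K) (hjle : ∀ x y : K', Valued.v (jK x) ≤ Valued.v (jK y) ↔ Valued.v x ≤ Valued.v y) (hjΘ : ∀ x, Θ (jK x) = jK x)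
    (hjfix : ∀ z : K, Θ z = z → ∃ x, jK x = z) (hjσ : ∀ x, jK (σ' x) = ρ (jK x)) (hjπ : Valued.v (jK π') = exp (-2 : ℤ))
    {ϖ : K} {dΘ tΘ : ℕ} (hDΘ : IsRamifiedQuadraticDatum Θ ϖ dΘ tΘ)
    (hFN : ∀ f : K, ρ f = f → Θ f = f → Valued.v f = 1 → ∃ x : K, x * Θ x = f)
    {n₀ : K} (hΘn₀ : Θ n₀ = n₀) (hn₀1 : Valued.v n₀ = 1) (hn₀N : ¬ ∃ z : K, z * Θ z = n₀)
    (hΘh : Θ h = h) (hh : h ≠ 0) {vh : ℤ} (hvh : Valued.v h = exp (-vh)) {e : ℤ} (he : vh + dρ = 2 * e)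
    {g s0 : ℕ} (hg : dΘ = 2 * g) (hds : 2 * d' = dρ + 2 * s0) (hs1 : 1 ≤ s0)
    (hcls0 : ∀ k₀ : ℤ, Valued.v (1 + ρ h / h * (ρ (α ^ k₀ * Θ (α ^ k₀)) / (α ^ k₀ * Θ (α ^ k₀)))) ≤ exp (-(2 * (d' : ℤ) - 2)))
    (hclsE : ∀ k₀ : ℤ, (∃ r : ℤ, k₀ + s0 + e = 2 * r) → ∃ ω₀ : Kˣ, Valued.v (ω₀ : K) = 1 ∧
      ρ h / h * (ρ (α ^ k₀ * Θ (α ^ k₀)) / (α ^ k₀ * Θ (α ^ k₀))) * (ρ ((ω₀ : K) * Θ ω₀) / ((ω₀ : K) * Θ ω₀)) * (ρ n₀ / n₀) = -1)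
    (hclsO : ∀ k₀ : ℤ, (∃ r : ℤ, k₀ + s0 + e = 2 * r + 1) → ∀ ω : Kˣ, Valued.v (ω : K) = 1 →
      ¬ Valued.v (1 + ρ h / h * (ρ (α ^ k₀ * Θ (α ^ k₀)) / (α ^ k₀ * Θ (α ^ k₀))) * (ρ ((ω : K) * Θ ω) / ((ω : K) * Θ ω))) ≤ exp (-(2 * (d' : ℤ))))
    (j a : ℕ) :
    (levelSet ρ Θ α ϖE h j a).ncard =
      (if j = 0 then (if a = 0 then 1 else 0) else if j < a then 0
        else if j - a + 1 = s0 then q ^ j else if j - a + 1 < s0 then (if a = 0 then q ^ j else 0) else if (j - a - s0) % 2 = 1 then 0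
        else if a = 0 then (if j - a - s0 + 2 ≤ 2 * g then q ^ (j - (j - a - s0) / 2) else 0)
        else if j - a - s0 + 2 < 2 * g then (q - 1) * q ^ (j - 1 - (j - a - s0) / 2) else if j - a - s0 + 2 = 2 * g then q ^ (j - (j - a - s0) / 2)
        else 0 : ℕ) := by
  have hΘΘ := hDΘ.1
  -- the cell's level index
  have hk₀ : vh + dρ + 2 * ((a : ℤ) - j - e) + 2 * j = 2 * a := by omega
  have row0 : 2 * (j : ℤ) + dρ + 2 ≤ 2 * d' → (levelSet ρ Θ α ϖE h j 0).ncard = q ^ j := fun hsh =>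
    ncard_levelSet_zero_eq_pow_of_shallow hD hΘΘ hvΘ hϖE hρϖ hq hσ' hfix' hπ' hdd' jK hjle hjfix hjσ hjπ hh hvh j (k₀ := (0 : ℤ) - j - e) (by omega)
      (hcls0 _) hsh
  have row1 : 1 ≤ a → 2 * (j : ℤ) + dρ + 3 ≤ 2 * a + 2 * d' → (levelSet ρ Θ α ϖE h j a).ncard = 0 := fun ha hsh =>
    ncard_levelSet_pos_eq_zero_of_shallow hD hΘΘ hΘρ hvΘ hϖE hρϖ hq hσ' hfix' hπ' hdd' jK hjle hjfix hjσ hjπ hh hvh j ha hk₀ (hcls0 _) hsh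
  by_cases hj0 : j = 0
  · subst hj0
    rw [if_pos rfl]
    by_cases ha0 : a = 0
    · subst ha0; rw [if_pos rfl, row0 (by omega), pow_zero]
    · rw [if_neg ha0]; exact row1 (by omega) (by push_cast; omega)
  rw [if_neg hj0]
  by_cases hja : j < a
  · rw [if_pos hja]; exact row1 (by omega) (by omega)
  rw [if_neg hja]
  by_cases hk1 : j - a + 1 = s0
  · rw [if_pos hk1]
    rcases Nat.eq_zero_or_pos a with rfl | ha
    · exact row0 (by omega)
    · exact ncard_levelSet_pos_eq_pow_of_notMet hD hΘρ hvΘ hϖE hρϖ hq hσ' hfix' hπ' hdd' jK hjle hjfix hjσ hjπ hDΘ hΘh hh hvh j ha hk₀ (hcls0 _)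
        (hclsO _ ⟨(a : ℤ) - j - e + s0 + e - 1 - ((a : ℤ) - j - e + s0 + e - 1) / 2 * 2 + ((a : ℤ) - j - e + s0 + e - 1) / 2, by omega⟩) (by omega)
  rw [if_neg hk1]
  by_cases hk2 : j - a + 1 < s0
  · rw [if_pos hk2]
    rcases Nat.eq_zero_or_pos a with rfl | ha
    · rw [if_pos rfl]; exact row0 (by omega)
    · rw [if_neg (by omega)]; exact row1 ha (by omega)
  rw [if_neg hk2]
  by_cases hodd : (j - a - s0) % 2 = 1
  · rw [if_pos hodd]
    have hpar : ∃ r : ℤ, (a : ℤ) - j - e + s0 + e = 2 * r + 1 := ⟨-(((j - a - s0) / 2 : ℕ) : ℤ) - 1, by omega⟩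
    rcases Nat.eq_zero_or_pos a with rfl | ha
    · exact ncard_levelSet_zero_eq_zero_of_notMet hD hvΘ hϖE hρϖ hh hvh j (k₀ := (0 : ℤ) - j - e) (by omega) fun ω hω hle =>
        hclsO _ (by simpa using hpar) ω hω (hle.trans (by rw [exp_le_exp]; omega))
    · exact ncard_levelSet_pos_eq_zero_of_notMet hD hvΘ hϖE hρϖ hh hvh j ha hk₀ fun ω hω hle =>
        hclsO _ hpar ω hω (hle.trans (by rw [exp_le_exp]; omega))
  rw [if_neg hodd]
  -- `k = 2n` even: the anchored class
  obtain ⟨n, hn⟩ : ∃ n : ℕ, j - a - s0 = 2 * n := ⟨(j - a - s0) / 2, by omega⟩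
  have hnk : (j - a - s0) / 2 = n := by omega
  obtain ⟨ω₀, hω₀, hanch⟩ := hclsE ((a : ℤ) - j - e) ⟨-(n : ℤ), by omega⟩
  rcases Nat.eq_zero_or_pos a with rfl | ha
  · rw [if_pos rfl, hnk, ncard_levelSet_zero_eq_of_anchor_even hD hΘρ hvΘ hϖE hρϖ hq hq' hσ' hvσ' hfix' hπ' hdd' jK hjle hjΘ hjfix hjσ hjπ hDΘ hFN hΘn₀ hn₀1 hn₀N
      hh hvh j (k₀ := (0 : ℤ) - j - e) (by omega) (n := n) (by omega) (by omega) hω₀ hanch]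
    by_cases hthr : 2 * n + 2 ≤ dΘ
    · rw [if_pos hthr, if_pos (show j - 0 - s0 + 2 ≤ 2 * g by omega)]
    · rw [if_neg hthr, if_neg (show ¬ (j - 0 - s0 + 2 ≤ 2 * g) by omega)]
  · rw [if_neg (by omega), hnk, ncard_levelSet_pos_eq_of_anchor_even hD hΘρ hvΘ hϖE hρϖ hq hq' hσ' hvσ' hfix' hπ' hdd' jK hjle hjΘ hjfix hjσ hjπ hDΘ hFN hΘn₀ hn₀1 hn₀N
      hΘh hh hvh j ha hk₀ (n := n) (by omega) (by omega) hω₀ hanch]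
    by_cases hlt : 2 * n + 2 < dΘ
    · rw [if_pos hlt, if_pos (show j - a - s0 + 2 < 2 * g by omega)]
    rw [if_neg hlt, if_neg (show ¬ (j - a - s0 + 2 < 2 * g) by omega)]
    by_cases heq : 2 * n + 2 = dΘ
    · rw [if_pos heq, if_pos (show j - a - s0 + 2 = 2 * g by omega)]
    · rw [if_neg heq, if_neg (show ¬ (j - a - s0 + 2 = 2 * g) by omega)]

end Summit.HodgeConjecture.HodgeConjecture.Cruxes.H413.F0P3cDyRamToricLevelCensusRamM

end
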